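import Mathlib
import Summits.ValiantsHypothesis.ValiantsHypothesis.Theses.PartialSorting
import Summits.ValiantsHypothesis.ValiantsHypothesis.Theorems.PartialSortingBoundedWidthInVPAutomaton
import Literature.Computability.AlgebraicComplexity.AutomatonIMM
import Literature.Computability.AlgebraicComplexity.IMMInVPProofs
import Literature.Computability.AlgebraicComplexity.DetInVP
import Literature.Computability.AlgebraicComplexity.ArithCircuitProofs

/-!
# ValiantsHypothesis / PartialSorting — `BoundedWidthInVP`

Route `PartialSorting`, item `stmt-ValiantsHypothesis-13595` (support): for every constant `c`,
the width-`c` truncated determinant family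
`(∑_{σ ∈ S_n : #{a ≤ t : σ(a) > t} ≤ c ∀ t} sgn σ · ∏_a x_{a σ(a)})_n` is a `VP` family over `ℂ`
(`boundedWidthInVP_proof`).

## Proof (transfer-matrix dynamic programme = layered automaton = projection of `IMM`)

Scan the positions `a = 0, …, n-1`, choosing `σ(a)`.  After `t` positions the *state* is the
set `A = σ({0, …, t-1})` of used values; the cut condition at `t-1` reads `#(A ∩ [t, n)) ≤ c`,
whence also `#([0,t) ∖ A) ≤ c`, so the admissible states are coded injectively into
`Fin (((n+1)^c)^2)`.  The letter read at position `t` is the pair `(σ(t), parity bit)`, accepted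
iff `σ(t) ∉ A`, the new state is admissible, and the bit is the parity of `#{u ∈ A : u > σ(t)}`
(the automaton and its runs: `PartialSortingBoundedWidthInVPAutomaton.lean`).  Here:

* the accepted words are exactly the words `wordOf σ` of the permutations of cut width `≤ c`
  (`filter_good_eq_image`), and the product of the layer signs `(-1)^{bit}` is `sgn σ`
  (`prod_pbit_eq_sign`, from `Equiv.Perm.sign_eq_prod_prod_Iio`); so the truncated determinant
  is the letter substitution `X⟨t,(v,b)⟩ ↦ (-1)^b x_{t v}` applied to the word polynomial
  (`truncDet_eq_sum_good`), which for `n ≥ 1` is `aeval` of the automaton substitution into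
  `IMM_{N,n}` (`LayeredAutomaton.aeval_autSubst_immPoly`; `truncDet_succ_eq_aeval`);
* complexity: `complexity_aeval_le` (Bürgisser 2000, Rem. 2.7) twice and `complexity_immPoly_le`
  (Kumar–Saraf 2017, §3) give `L ≤ (N + 2N³n) + n N² · 2n + 2n²`, `N = ((n+1)^c)^2`
  (`complexity_truncDet_le`); the family has `n²` variables and is homogeneous of degree `n`
  (`truncDet_isHomogeneous`), hence `isVPFamily_truncDet`.

## References

* P. Bürgisser, *Completeness and Reduction in Algebraic Complexity Theory*, Springer 2000,
  Def. 2.1–2.4, Rem. 2.7.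
* A. Björner, F. Brenti, *Combinatorics of Coxeter Groups*, GTM 231, Springer 2005, §2.1.
* N. Limaye, S. Srinivasan, S. Tavenas, J. ACM 72 (2025), Art. 26, Lemma 8 / Lemma 22.
* M. Kumar, S. Saraf, SIAM J. Comput. 46 (2017), §3 (`IMM ∈ VP`).
-/

-- The sub-problem of the single-problem summit `ValiantsHypothesis` is `ValiantsHypothesis`
-- (Sub = Summit), so the duplicated namespace component `…ValiantsHypothesis.ValiantsHypothesis…`
-- is the tree's convention; silence the corresponding linter for this file.
set_option linter.dupNamespace false

noncomputable section

open MvPolynomial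
open Literature.Computability.AlgebraicComplexity

namespace Summit.ValiantsHypothesis.ValiantsHypothesis.Theorems.PartialSortingBoundedWidth

open scoped Classical

/-! ### Accepted words are the bounded-width permutations, with their signs -/

section Words

variable {n c : ℕ}

/-- `#(img σ (t+1) ∩ [t+1, n)) = #{a ≤ t : t < σ a}` (the cut width at `t`). [folklore] -/
theorem card_filter_img_succ (σ : Fin n → Fin n) (hσ : Function.Injective σ) (t : Fin n) :
    ((img σ ((t : ℕ) + 1)).filter fun u : Fin n => (t : ℕ) + 1 ≤ (u : ℕ)).card =
      (Finset.univ.filter fun a : Fin n => a ≤ t ∧ t < σ a).card := by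
  unfold img seg
  rw [Finset.filter_image, Finset.card_image_of_injective _ hσ, Finset.filter_filter]
  congr 1
  ext a
  simp only [Finset.mem_filter, Finset.mem_univ, true_and, Fin.le_def, Fin.lt_def]
  omega

/-- `#(img σ t) = t` for injective `σ` and `t ≤ n`. [folklore] -/
theorem card_img (σ : Fin n → Fin n) (hσ : Function.Injective σ) {t : ℕ} (ht : t ≤ n) :
    (img σ t).card = t := by
  unfold img
  rw [Finset.card_image_of_injective _ hσ, card_seg ht]

/-- The parity bit of `σ` at layer `t`: the parity of the number of new inversions. [folklore] -/
def pbit (σ : Fin n → Fin n) (t : Fin n) : Bool := decide (Odd (cnt (img σ t) (σ t)))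

/-- The accepted word of a permutation. [folklore] -/
def wordOf (σ : Equiv.Perm (Fin n)) : Fin n → Letter n := fun t => (σ t, pbit σ t)

/-- `wordOf` is injective. [folklore] -/
theorem wordOf_injective : Function.Injective (wordOf (n := n)) := by
  intro σ τ h
  ext t
  have := congrFun h t
  simp only [wordOf, Prod.mk.injEq] at this
  rw [this.1]

/-- **Good words = words of the permutations of cut width `≤ c`.** [folklore] -/
theorem filter_good_eq_image :
    (Finset.univ.filter fun w : Fin n → Letter n => Good n c w n) =
      (Finset.univ.filter fun σ : Equiv.Perm (Fin n) =>
        ∀ t : Fin n, (Finset.univ.filter (fun a : Fin n => a ≤ t ∧ t < σ a)).card ≤ c).image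
        wordOf := by
  ext w
  simp only [Finset.mem_filter, Finset.mem_univ, true_and, Finset.mem_image]
  constructor
  · rintro ⟨hinj, hcl⟩
    have hinj' : Function.Injective fun j => (w j).1 := fun i j h => hinj i j i.2 j.2 h
    refine ⟨Equiv.ofBijective _ (Finite.injective_iff_bijective.mp hinj'), fun t => ?_, ?_⟩
    · have h := (hcl t t.2).1.2
      rw [card_filter_img_succ _ hinj' t] at h
      exact h
    · funext t
      exact Prod.ext rfl ((hcl t t.2).2).symm
  · rintro ⟨σ, hW, rfl⟩
    refine ⟨fun i j _ _ h => σ.injective h, fun i hi => ⟨⟨card_img σ σ.injective hi, ?_⟩, rfl⟩⟩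
    show ((img σ ((i : ℕ) + 1)).filter fun u : Fin n => (i : ℕ) + 1 ≤ (u : ℕ)).card ≤ c
    rw [card_filter_img_succ σ σ.injective i]
    exact hW i

/-- The number of new inversions at layer `t` is the number of earlier positions carrying a
larger value. [folklore] -/
theorem cnt_img_eq (σ : Equiv.Perm (Fin n)) (t : Fin n) :
    cnt (img σ t) (σ t) = ((Finset.Iio t).filter fun i => ¬ σ i < σ t).card := by
  unfold cnt img seg
  rw [Finset.filter_image, Finset.card_image_of_injective _ σ.injective, Finset.filter_filter]
  congr 1
  ext i
  simp only [Finset.mem_filter, Finset.mem_univ, true_and, Finset.mem_Iio, not_lt]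
  constructor
  · rintro ⟨hi, hlt⟩
    exact ⟨Fin.lt_def.mpr hi, hlt.le⟩
  · rintro ⟨hi, hle⟩
    exact ⟨Fin.lt_def.mp hi, lt_of_le_of_ne hle fun h => ne_of_lt hi (σ.injective h).symm⟩

/-- **The product of the layer signs is `sgn σ`** (`sgn σ = ∏_j ∏_{i<j} ±1`,
`Equiv.Perm.sign_eq_prod_prod_Iio`). [folklore] -/
theorem prod_pbit_eq_sign (σ : Equiv.Perm (Fin n)) :
    (∏ t : Fin n, (if pbit σ t then -1 else 1 : ℤˣ)) = Equiv.Perm.sign σ := by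
  rw [Equiv.Perm.sign_eq_prod_prod_Iio]
  refine Finset.prod_congr rfl fun t _ => ?_
  rw [Finset.prod_ite, Finset.prod_const_one, one_mul, Finset.prod_const, ← cnt_img_eq,
    neg_one_pow_eq_ite]
  simp only [pbit, decide_eq_true_eq]
  rcases Nat.even_or_odd (cnt (img σ t) (σ t)) with h | h
  · rw [if_pos h, if_neg (Nat.not_odd_iff_even.mpr h)]
  · rw [if_pos h, if_neg (Nat.not_even_iff_odd.mpr h)]

variable (n) in
/-- The letter substitution `X⟨t, (v, b)⟩ ↦ (-1)^b · x_{t v}`. [folklore] -/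
def letterSubst (x : Σ _ : Fin n, Letter n) : MvPolynomial (Fin n × Fin n) ℂ :=
  if x.2.2 then -X (x.1, x.2.1) else X (x.1, x.2.1)

/-- On the word of `σ` the substituted monomial is `sgn σ · x^σ`. [folklore] -/
theorem prod_letterSubst_wordOf (σ : Equiv.Perm (Fin n)) :
    (∏ t : Fin n, letterSubst n ⟨t, wordOf σ t⟩) =
      Equiv.Perm.sign σ • ∏ t : Fin n, X (t, σ t) := by
  have h1 : ∀ t : Fin n, letterSubst n ⟨t, wordOf σ t⟩ =
      C ((((if pbit σ t then -1 else 1 : ℤˣ) : ℤ) : ℂ)) * X (t, σ t) := by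
    intro t
    unfold letterSubst wordOf
    dsimp only
    cases pbit σ t <;> simp
  simp_rw [h1]
  rw [Finset.prod_mul_distrib, ← map_prod C, ← Int.cast_prod, ← Units.coe_prod,
    prod_pbit_eq_sign, Units.smul_def, ← Int.cast_smul_eq_zsmul ℂ, smul_eq_C_mul]

variable (n c) in
/-- The width-`c` truncated determinant: the `n`-th member of the route's family, verbatim.
[folklore] -/
def truncDet : MvPolynomial (Fin n × Fin n) ℂ :=
  ∑ σ : Equiv.Perm (Fin n), if (∀ t : Fin n, (Finset.univ.filter (fun a : Fin n => a ≤ t ∧ t < σ a)).card ≤ c) then Equiv.Perm.sign σ • ∏ a : Fin n, MvPolynomial.X (a, σ a) else (0 : MvPolynomial (Fin n × Fin n) ℂ)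

/-- **The truncated determinant is the sum over the good words of the substituted monomials.**
[folklore] -/
theorem truncDet_eq_sum_good :
    truncDet n c = ∑ w : Fin n → Letter n,
      if Good n c w n then ∏ t : Fin n, letterSubst n ⟨t, w t⟩ else 0 := by
  rw [← Finset.sum_filter, filter_good_eq_image, Finset.sum_image wordOf_injective.injOn]
  unfold truncDet
  rw [← Finset.sum_filter]
  exact Finset.sum_congr rfl fun σ _ => (prod_letterSubst_wordOf σ).symm

/-- **The automaton identity**: for `n ≥ 1` the truncated determinant is the letter substitution
applied to the automaton substitution applied to `IMM_{N, n}`, `N = ((n+1)^c)^2`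
(`LayeredAutomaton.aeval_autSubst_immPoly`). [folklore] -/
theorem truncDet_succ_eq_aeval (n c : ℕ) :
    truncDet (n + 1) c = aeval (letterSubst (n + 1))
      (aeval (LayeredAutomaton.autSubst (K := ℂ) (St := St (n + 1) c)
        (In := fun _ => Letter (n + 1)) (start (n + 1) c) (step (n + 1) c) (enc (n + 1) c))
        (immPoly (nSt (n + 1) c) (n + 1) ℂ)) := by
  rw [LayeredAutomaton.aeval_autSubst_immPoly (K := ℂ) (St := St (n + 1) c) (start (n + 1) c)
    (step (n + 1) c) (enc (n + 1) c) (fun t ht => enc_injective t ht) (Nat.succ_pos n),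
    map_sum, truncDet_eq_sum_good]
  refine Finset.sum_congr rfl fun w _ => ?_
  by_cases hg : Good (n + 1) c w (n + 1)
  · rw [if_pos hg, if_pos ((accepts_iff_good w).mpr hg), map_prod]
    simp only [aeval_X]
  · rw [if_neg hg, if_neg (mt (accepts_iff_good w).mp hg), map_zero]

end Words

/-! ### Complexity, degree, and the `VP` bound -/

section Complexity

variable {n c : ℕ}

/-- Each substituted letter costs at most one gate. [folklore] -/
theorem complexity_letterSubst_le (x : Σ _ : Fin n, Letter n) :
    complexity (letterSubst n x) ≤ 1 := by
  unfold letterSubst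
  split_ifs
  · exact (complexity_neg_le _).trans (by rw [complexity_X_holds])
  · rw [complexity_X_holds]
    exact Nat.zero_le _

/-- Each entry of the automaton substitution is a `0/1`-combination of the `2n` letters of its
layer: cost `≤ 2n`. [folklore] -/
theorem complexity_autSubst_le [Inhabited (Fin n)] (v : Fin n × Fin (nSt n c) × Fin (nSt n c)) :
    complexity (LayeredAutomaton.autSubst (K := ℂ) (St := St n c) (In := fun _ => Letter n)
      (start n c) (step n c) (enc n c) v) ≤ Fintype.card (Letter n) := by
  unfold LayeredAutomaton.autSubst
  refine (complexity_finset_sum_le _ _).trans ?_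
  have h0 : ∀ b : Letter n, complexity ((if LayeredAutomaton.Trans (St := St n c) (start n c)
      (step n c) (enc n c) v.1 v.2.1 b v.2.2 then X ⟨v.1, b⟩ else 0 :
        MvPolynomial (Σ _ : Fin n, Letter n) ℂ)) = 0 := by
    intro b
    split_ifs
    · exact complexity_X_holds _
    · simpa using complexity_C_holds (σ := Σ _ : Fin n, Letter n) (0 : ℂ)
  simp only [h0, Finset.sum_const_zero, zero_add, Finset.card_univ]
  rfl

/-- **Complexity for `n ≥ 1`**: the `IMM` circuit plus the two substitutions
(`complexity_aeval_le`, `complexity_immPoly_le`). [folklore] -/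
theorem complexity_truncDet_succ_le (n c : ℕ) :
    complexity (truncDet (n + 1) c) ≤
      (nSt (n + 1) c + 2 * nSt (n + 1) c ^ 3 * (n + 1)) +
        (n + 1) * (nSt (n + 1) c * nSt (n + 1) c) * ((n + 1) * 2) + (n + 1) * ((n + 1) * 2) := by
  rw [truncDet_succ_eq_aeval]
  refine (complexity_aeval_le _ _).trans (Nat.add_le_add ?_ ?_)
  · refine (complexity_aeval_le _ _).trans (Nat.add_le_add (complexity_immPoly_le ℂ _ _) ?_)
    calc ∑ v, complexity (LayeredAutomaton.autSubst (K := ℂ) (St := St (n + 1) c)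
          (In := fun _ => Letter (n + 1)) (start (n + 1) c) (step (n + 1) c) (enc (n + 1) c) v)
        ≤ ∑ _v : Fin (n + 1) × Fin (nSt (n + 1) c) × Fin (nSt (n + 1) c),
            Fintype.card (Letter (n + 1)) :=
          Finset.sum_le_sum fun v _ => complexity_autSubst_le v
      _ = (n + 1) * (nSt (n + 1) c * nSt (n + 1) c) * ((n + 1) * 2) := by
          simp only [Finset.sum_const, Finset.card_univ, smul_eq_mul, Fintype.card_prod,
            Fintype.card_fin, Fintype.card_bool]
  · calc ∑ x, complexity (letterSubst (n + 1) x)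
        ≤ ∑ _x : (Σ _ : Fin (n + 1), Letter (n + 1)), 1 :=
          Finset.sum_le_sum fun x _ => complexity_letterSubst_le x
      _ = (n + 1) * ((n + 1) * 2) := by
          simp only [Finset.sum_const, Finset.card_univ, smul_eq_mul, mul_one, Fintype.card_sigma,
            Fintype.card_prod, Fintype.card_fin, Fintype.card_bool]

/-- For `n = 0` the truncated determinant is a constant. [folklore] -/
theorem complexity_truncDet_zero (c : ℕ) : complexity (truncDet 0 c) = 0 := by
  have h : truncDet 0 c = C (∑ σ : Equiv.Perm (Fin 0),
      if (∀ t : Fin 0, (Finset.univ.filter (fun a : Fin 0 => a ≤ t ∧ t < σ a)).card ≤ c)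
      then (((Equiv.Perm.sign σ : ℤ)) : ℂ) else 0) := by
    unfold truncDet
    rw [map_sum]
    refine Finset.sum_congr rfl fun σ _ => ?_
    split_ifs
    · rw [Finset.univ_eq_empty, Finset.prod_empty, Units.smul_def, ← Int.cast_smul_eq_zsmul ℂ,
        smul_eq_C_mul, mul_one]
    · exact (map_zero C).symm
  rw [h, complexity_C_holds]

/-- **Complexity bound**, all `n`. [folklore] -/
theorem complexity_truncDet_le (n c : ℕ) :
    complexity (truncDet n c) ≤
      (nSt n c + 2 * nSt n c ^ 3 * n) + n * (nSt n c * nSt n c) * (n * 2) + n * (n * 2) := by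
  cases n with
  | zero =>
    rw [complexity_truncDet_zero]
    exact Nat.zero_le _
  | succ m => exact complexity_truncDet_succ_le m c

/-- The truncated determinant is homogeneous of degree `n`. [folklore] -/
theorem truncDet_isHomogeneous (n c : ℕ) : (truncDet n c).IsHomogeneous n := by
  unfold truncDet
  refine IsHomogeneous.sum _ _ _ fun σ _ => ?_
  split_ifs
  · rw [Units.smul_def, ← Int.cast_smul_eq_zsmul ℂ, smul_eq_C_mul]
    have h := (isHomogeneous_C (Fin n × Fin n) (((Equiv.Perm.sign σ : ℤ)) : ℂ)).mul
      (IsHomogeneous.prod Finset.univ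
        (fun a : Fin n => (X (a, σ a) : MvPolynomial (Fin n × Fin n) ℂ)) (fun _ => 1)
        fun a _ => isHomogeneous_X ℂ _)
    simpa using h
  · exact isHomogeneous_zero _ _ _

/-- **The width-`c` truncated determinant family is in `VP`**: `n²` variables, degree `n`,
polynomially bounded complexity. [folklore] -/
theorem isVPFamily_truncDet (c : ℕ) : IsVPFamily (k := ℂ) fun n => truncDet n c := by
  have hN : IsPBounded fun n => nSt n c :=
    IsPBounded.pow_holds
      (IsPBounded.pow_holds (IsPBounded.add_holds IsPBounded.id (IsPBounded.const 1)) c) 2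
  refine ⟨⟨?_, ?_⟩, ?_⟩
  · exact (IsPBounded.mul_holds IsPBounded.id IsPBounded.id).mono fun n => by
      simp [Fintype.card_prod]
  · exact IsPBounded.id.mono fun n => (truncDet_isHomogeneous n c).totalDegree_le
  · have hB : IsPBounded fun n =>
        (nSt n c + 2 * nSt n c ^ 3 * n) + n * (nSt n c * nSt n c) * (n * 2) + n * (n * 2) :=
      IsPBounded.add_holds
        (IsPBounded.add_holds
          (IsPBounded.add_holds hN (IsPBounded.mul_holds
            (IsPBounded.mul_holds (IsPBounded.const 2) (IsPBounded.pow_holds hN 3)) IsPBounded.id))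
          (IsPBounded.mul_holds (IsPBounded.mul_holds IsPBounded.id (IsPBounded.mul_holds hN hN))
            (IsPBounded.mul_holds IsPBounded.id (IsPBounded.const 2))))
        (IsPBounded.mul_holds IsPBounded.id (IsPBounded.mul_holds IsPBounded.id (IsPBounded.const 2)))
    exact hB.mono fun n => complexity_truncDet_le n c

end Complexity

end Summit.ValiantsHypothesis.ValiantsHypothesis.Theorems.PartialSortingBoundedWidth

namespace Summit.ValiantsHypothesis.ValiantsHypothesis.Theorems

/-- Settles `stmt-ValiantsHypothesis-13595` (`BoundedWidthInVP`, route `PartialSorting`): for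
every constant `c`, the width-`c` truncated determinant family
`(∑_{σ : #{a ≤ t : t < σ a} ≤ c ∀ t} sgn σ ∏_a x_{a σ a})_n` is a `VP` family over `ℂ` — the
transfer-matrix dynamic programme over (used values `≥ t`, unused values `< t`), realised as a
layered automaton and hence as a projection of iterated matrix multiplication. [folklore] -/
theorem boundedWidthInVP_proof :
    Summit.ValiantsHypothesis.ValiantsHypothesis.Theses.PartialSorting.BoundedWidthInVP := by
  unfold Summit.ValiantsHypothesis.ValiantsHypothesis.Theses.PartialSorting.BoundedWidthInVP
  intro c
  exact PartialSortingBoundedWidth.isVPFamily_truncDet c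

end Summit.ValiantsHypothesis.ValiantsHypothesis.Theorems
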